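import Summits.QuantumFields.BalabanUV.T4Continuum.Support.NE9CurveRemainderLinear
import Summits.QuantumFields.BalabanUV.T4Continuum.Support.NE9Lemma1CurveSpecies
import Summits.QuantumFields.BalabanUV.T4Continuum.Support.NE9RemainderSpeciesCoupling

/-!
# NE9CurveSpeciesCoupling — leaf A3 for the CURVE SPECIES: the per-piece COUPLING response of the owner's corrected species piece
# form `CurData.toC` PROVED on the ANALYTIC class, and the END's `hTcup` clause for its channel with a k-uniform constant (cell
# `pub-balaban`, T4-DAG §2 node U3 ∕ §6 NE9; NE9 formalisation swarm, unit `b2b-balaban-t4-ne9-formalise-leaf-05` gen 5; crew row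
# (w20) «A3-REM twin on `CurData`» of the row OWNER t4-ne9-p1 g25 (CLAIMS.log l.9603), SPECIES HALF, CLAIM l.10038 — the generic
# halves are leaf-06-g7's engine `NE9CurveRemainderCoupling` p213961 and the sibling `NE9CurveRemainderLinear` (the identity); the
# ray predecessor is leaf-03-g4's A3-REM `NE9RemainderSpeciesCoupling` p213083, recovered in §3 as the special case)

HONEST FRAMING (T4-DAG PAGE 1).  Rung (B)+1 of the FINITE-VOLUME T⁴ programme — existence AND uniqueness of the ε → 0 limit
of gauge-invariant observables on a fixed torus; NOT infinite volume, NOT a mass gap, NOT the Clay problem.  NE9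
(`T4OutputRate.NE9` ∧ `FadingMemory`) is a cell NEW ESTIMATE, NOT PRINTED, and is NOT discharged here («NE9 ⇐ the named
binders»); spine 0∕9; 0∕18 skeleton leaves instantiated on Bałaban's objects (O-NE9-1).  HONEST DEPENDENCY (cell line,
verbatim): continuum YM on T⁴ ⇐ BetaPertH ∧ nine spine estimates (0/9 proved); BetaPertH ⇐ (D1) ∧ (D4) ∧ CAP+tail; G-an2-4
gates asym, D1 and NE2/3/4.  Everything below concerns the owner's FORM-level CURVE datum `CurData` ∕ `CurData.toC` on the
doubled carriers (t4-ne9-p1 g25, LOCATED CORRECTION O-ne9p1g25-1: [I] (3.34)∕(3.54) expand the old term along the analytic CURVE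
σ′ ↦ U_j(□₀, exp i(B + σ′B))|_X of Lemma 4 (3.53) — a ray only for abelian G) and an abstract window family of old terms; [I] =
[Balaban1987RG1] (CMP **109**), [II] = [Balaban1988RG2Cluster] (CMP **116**) are quoted for TYPES only (ABSOLUTE RULE: nothing
printed in the audited series is asserted).  No `def`, no Prop-valued definition (trigger c3: A3's binders stay displayed
hypotheses); `FlowStep.BetaPertH`, (B), (B^μ) do not occur.

WHERE THIS SITS.  The END faces display A3 = `hTcup : |T k g (E g) y − T k g′ (E g) y| ≤ wt k y·(qT k·|g k − g′ k|)` (the channel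
read at two coupling ARGUMENTS on the SAME old terms); on a class-relative piece form it is ONE per-piece COUPLING-RESPONSE bound
`hresp` (`NE9CPieceCouplingModulus.channelCouplingModulus_cpiece`, leaf-09-g4).  The owner's part 2 (p213869) re-typed the
DISPLAYED species with analytic SLICE CURVES `D.cur k s …` (the coupling history `s` enters through the shift amplitude, [II]
(1.21)) and PROVED its S5 bound `pieceBoundOnG_cur` on the ANALYTIC class; the sibling `NE9CurveRemainderLinear.norm_curPiece_sub
_curPiece_le` is the coupling twin of the owner's `norm_curPiece_le`.  THIS FILE puts them together:
* §1 **`cpieceResponse_cur`** — `hresp` for `D.toC` at a window family `E g ∈ analyticClass D.R` with the inductive size (1.18)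
  `TermSize E W κ N` (`0 ≤ N j ≤ Nbar`), from `D.Admissible ℓ c_dir d₀` BY NAME, A3-REM's `hhalf : c_dir·ℓ k j < ½` (so the INNER
  DISC `|τ| < ϱ₁ := (2c_dir·ℓ k j)⁻¹` has `ϱ₁ > 1` and lies inside every slice disc by `ϱ_inv_le`) and THREE DISPLAYED CURVE
  BINDERS (TYPE [I] Lemma 4 (3.53) p. 280, [II] (1.21)–(1.23) p. 7; asserted for nothing of Bałaban's): (c1) `hcont` JOINT
  CONTINUITY of `(t, s′, σ′, τ) ↦ D.cur k s … t s′ σ′ τ` on `({|t| = r_k} × contour) × {|τ| = 1}`; (c2) `hlip` LIPSCHITZ IN THE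
  k-TH COUPLING on the inner disc with displacement `≤ clip·(R_X∕2)·|g k − g′ k|`; (c3) `hroom` ROOM on the inner disc:
  `‖D.cur … τ‖ ≤ R_X∕2`.  CONCLUSION LITERALLY the `hresp` binder at `P := D.toC`, `Kp := D.Kp c_dir` (= 64c_dir⁵∕r_k), gain
  `ℓ⁵`, **`qc := 64·clip·Nbar`** — THE SAME LETTERS as A3-REM p213083.
* §2 **`channelCouplingModulus_cur`** — the END's `hTcup` for `T := cpieceChannel D.toC` at `E` with the S5 weight of the owner's
  `channelSizeAtStepNN_cur` and **`qT := 64·clip·Nbar·c_Q·(1−ω)⁻¹`**, by `channelCouplingModulus_cpiece` BY NAME with the level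
  counts `LevelCountsG D.toC.frame κ κ₁ O1 c_Q (ℓ⁵) (agePow ω)`.
* §3 RAY CONSISTENCY (`example`): A3-REM's `cpieceResponse_rem` — its binders (d1)–(d3) on a ray datum + the owner's displayed
  `0 < dirB` — follows from §1 at the curve reading `RemData.toCur` (`RemData.toCur_toC` rfl): the abelian sub-case is recovered,
  nothing landed is lost.
So leaf A3 for the curve species is KERNEL AT FORM LEVEL modulo `CurData.Admissible`, analyticity + (1.18) of the family,
(c1)–(c3), `hhalf`, the counts and scalars — the A3 twin of S5's status after p213869.  NOT TAKEN: the END face at the curve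
species with `hTcup` discharged (sequel, after the owner's part 3 `NE9Lemma1CurveSpeciesEnd`), (w19) additivity (leaf-08-g4), the
(w21) twins.  NOT PRINTED and not claimed: that Bałaban's (1.23) pieces, 𝐇_k, Lemma 4's curves and U^c_j meet these binders
(O-NE9-1 ∕ O-NE9-5).  DISGUISE TEST: last coupling only, the SAME old terms at two histories, one species — no history comparison
of terms; not NE9.

WHAT IS PROVED (kernel, `[folklore]`; 0 sorry, 0 `def`): §1 `cpieceResponse_cur`; §2 `channelCouplingModulus_cur`; §3 one
`example`.

References (TYPES only): T. Bałaban, *Renormalization group approach to lattice gauge field theories. I*, Commun. Math. Phys.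
**109** (1987) 249–301 [Balaban1987RG1], (0.30) p. 258, (3.34)∕(3.37) p. 277, Lemma 4 (3.53)–(3.54) p. 280; T. Bałaban, *… II.
Cluster expansions*, Commun. Math. Phys. **116** (1988) 1–22 [Balaban1988RG2Cluster], (1.21)–(1.25) p. 7, (1.26)–(1.29) p. 8,
(1.33)–(1.36) p. 9.  Summits-side NEW work (LEAN PLACEMENT RULE); imports the sibling `NE9CurveRemainderLinear`, the owner's
`NE9Lemma1CurveSpecies` and leaf-03-g4's `NE9RemainderSpeciesCoupling` (hence leaf-09-g4's `NE9CPieceCouplingModulus`) BY NAME;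
modifies nothing; no END face re-wired.  Value = a binder reduction (A3 for the curve species at form level), NOT summit progress.
-/

noncomputable section

namespace Summit.QuantumFields.BalabanUV.T4Continuum.NE9CurveSpeciesCoupling

open scoped BigOperators
open Metric Set Complex
open Literature.MathematicalPhysics.QuantumFieldTheory.Balaban1983to89
open Literature.MathematicalPhysics.QuantumFieldTheory.Balaban1983to89.T4OutputRate
open Literature.MathematicalPhysics.QuantumFieldTheory.Balaban1983to89.T4HistoryLipschitzRecursion
open Literature.MathematicalPhysics.QuantumFieldTheory.Balaban1983to89.T4HistoryLipschitzSegment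
open Summit.QuantumFields.BalabanUV.T4Continuum.NE9Lemma1Counting
open Summit.QuantumFields.BalabanUV.T4Continuum.NE9Lemma1Gain
open Summit.QuantumFields.BalabanUV.T4Continuum.NE9Lemma1PieceClass
open Summit.QuantumFields.BalabanUV.T4Continuum.NE9Lemma1RemainderPiece
open Summit.QuantumFields.BalabanUV.T4Continuum.NE9Lemma1RemainderSpecies
open Summit.QuantumFields.BalabanUV.T4Continuum.NE9Lemma1CurveRemainder
open Summit.QuantumFields.BalabanUV.T4Continuum.NE9Lemma1CurveSpecies
open Summit.QuantumFields.BalabanUV.T4Continuum.NE9CurveRemainderLinear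
open Summit.QuantumFields.BalabanUV.T4Continuum.NE9CPieceCouplingModulus
open Summit.QuantumFields.BalabanUV.T4Continuum.NE9RemainderSpeciesCoupling
open Summit.QuantumFields.BalabanUV.T4Continuum.NE9ComplexEncoding (doubleCarriers)

/-! ## §1 The per-piece coupling response of the CURVE species, PROVED on the analytic class -/

section Species

variable {C : Carriers} {E : Type} [NormedAddCommGroup E] [NormedSpace ℂ E] {ι α β γ δ : Type} [DecidableEq δ]

/-- **THE PER-PIECE COUPLING RESPONSE OF THE CURVE SPECIES, PROVED ON THE ANALYTIC CLASS (kernel; the theorem of this leaf —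
the A3 analogue of the owner's S5 `pieceBoundOnG_cur`, the curve twin of A3-REM's `cpieceResponse_rem`).**  Data: the owner's
curve datum `D : CurData` with its displayed binders `D.Admissible ℓ c_dir d₀` (κ₁ ≥ 1, radii, Lemma-4 TYPE analyticity + domain
inclusion of the slice curves ON THE CONTOURS, `ϱ > 1`, the gain `ϱ⁻¹ ≤ c_dir·ℓ k j`, source discipline, G1 — BY NAME); a window
family `E` of old terms ANALYTIC on the balls (`E g ∈ analyticClass D.R`) with the inductive size (1.18) `TermSize E W κ N`,
`0 ≤ N j ≤ Nbar`; A3-REM's `hhalf : c_dir·ℓ k j < ½` (`0 < c_dir`, `0 < ℓ`), so that the INNER DISC `|τ| < ϱ₁ := (2c_dir·ℓ k j)⁻¹`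
has `ϱ₁ > 1` and lies inside every slice disc; and THREE DISPLAYED CURVE BINDERS (TYPE [I] Lemma 4 (3.53) p. 280 *"(U_j(□₀,
exp i(τB + B′)), …)|_X ∈ U^c_j(X, α₀, α₁)"*, [II] (1.21)–(1.23) p. 7 *"|𝐇_k(s(Y₀), B′)| ≦ 4B₀C₁e^{16κ₁}g_k|B|"* — asserted for
nothing of Bałaban's): (c1) `hcont` JOINT CONTINUITY of the slice-curve family `(t, s′, σ′, τ) ↦ D.cur k s … t s′ σ′ τ` on
`({|t| = r_k} × contour) × {|τ| = 1}`; (c2) `hlip` LIPSCHITZ IN THE k-TH COUPLING on the inner disc, displacement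
`≤ clip·(R_X∕2)·|g k − g′ k|` (the shift is linear in g_k, (1.21); per unit of the room radius); (c3) `hroom` ROOM on the inner
disc: `‖D.cur … τ‖ ≤ R_X∕2` (the ½ is our normalisation of *"inside"* U^c_j, as A3-REM's (d3); not a printed number).
CONCLUSION: LITERALLY the `hresp` binder of `NE9CPieceCouplingModulus.channelCouplingModulus_cpiece` at `P := D.toC`,
`Kp := D.Kp c_dir` (= 64c_dir⁵∕r_k, the owner's S5 constant), `gain := ℓ⁵`, **`qc := 64·clip·Nbar`** (k-uniform) — THE SAME
LETTERS as A3-REM p213083.  Proof: `|Re∕Im z − Re∕Im w| ≤ ‖z − w‖`; the sibling's `norm_curPiece_sub_curPiece_le` on the inner disc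
(`ϱ₁ = (2c_dirℓ)⁻¹`, `R′ = R_X∕2`, `M := 2e^{−κd(X)}N_j` — the size on BOTH copies of X, `norm_lift_le` — `δ := clip·(R_X∕2)·|Δg_k|`):
`(1∕r)·2⁵·(4M∕R)·δ·(2c_dirℓ)⁵ = (64c_dir⁵∕r)·(64·clip·N_j)·ℓ⁵·e^{−κd}·|Δg_k|`; then `B13Sect1Arith.bound_125` under G1.
[cite: Balaban1987RG1, (3.53)-(3.54) p.280; Balaban1988RG2Cluster, (1.21)-(1.25) p.7] -/
theorem cpieceResponse_cur {D : CurData C E ι α β γ δ} {ℓ : ℕ → ℕ → ℝ} {cdir d0 : ℝ} (hD : D.Admissible ℓ cdir d0)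
    {Ef : Functional (doubleCarriers C) E} {W : Set (ℕ → ℝ)} {κ : ℝ} {N : ℕ → ℝ} {Nbar clip : ℝ}
    (hE : ∀ g ∈ W, Ef g ∈ analyticClass D.R) (hT : TermSize Ef W κ N) (hN0 : ∀ j, 0 ≤ N j) (hNb : ∀ j, N j ≤ Nbar)
    (hclip : 0 ≤ clip) (hcdir : 0 < cdir) (hℓ : ∀ k j, 0 < ℓ k j) (hhalf : ∀ k j, cdir * ℓ k j < 1 / 2)
    (hcont : ∀ (k : ℕ) (s : ℕ → ℝ) (y : ι) (a : α) (b : β) (x : (doubleCarriers C).Dom),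
      ContinuousOn (fun q : (ℂ × ((δ → ℝ) × (δ → ℂ))) × ℂ => D.cur k s y a b x q.1.1 q.1.2.1 q.1.2.2 q.2)
        ((sphere (0:ℂ) (D.r k) ×ˢ {q | OnContour D.κ₁ (D.cubes k y a b) q.1 q.2}) ×ˢ sphere (0:ℂ) 1))
    (hlip : ∀ g ∈ W, ∀ g' ∈ W, ∀ (k : ℕ) (y : ι), ∀ a ∈ D.S0 k y, ∀ b ∈ D.SY k y a, ∀ (j : ℕ), ∀ x ∈ D.src k y a j,
      ∀ t ∈ sphere (0:ℂ) (D.r k), ∀ (s' : δ → ℝ) (σ' : δ → ℂ), OnContour D.κ₁ (D.cubes k y a b) s' σ' →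
        ∀ τ ∈ ball (0:ℂ) (1 / (2 * (cdir * ℓ k j))),
          ‖D.cur k g y a b x t s' σ' τ - D.cur k g' y a b x t s' σ' τ‖ ≤ clip * (D.R x.1 / 2) * |g k - g' k|)
    (hroom : ∀ g ∈ W, ∀ (k : ℕ) (y : ι), ∀ a ∈ D.S0 k y, ∀ b ∈ D.SY k y a, ∀ (j : ℕ), ∀ x ∈ D.src k y a j,
      ∀ t ∈ sphere (0:ℂ) (D.r k), ∀ (s' : δ → ℝ) (σ' : δ → ℂ), OnContour D.κ₁ (D.cubes k y a b) s' σ' →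
        ∀ τ ∈ ball (0:ℂ) (1 / (2 * (cdir * ℓ k j))), ‖D.cur k g y a b x t s' σ' τ‖ ≤ D.R x.1 / 2) :
    ∀ g ∈ W, ∀ g' ∈ W, ∀ (k : ℕ) (y : ι), ∀ a ∈ D.toC.S0 k y, ∀ b ∈ D.toC.SY k y a, ∀ (j : ℕ), ∀ x ∈ D.toC.src k y a j,
      |D.toC.piece k g y a b x (Ef g) - D.toC.piece k g' y a b x (Ef g)| ≤
        D.Kp cdir k y * (64 * clip * Nbar) * ℓ k j ^ 5 * Real.exp (-(κ * (doubleCarriers C).d x)) *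
          Real.exp (-(1 / 8) * (D.κ₁ - 1) * D.toC.dY k y + (1 / 8) * D.κ₁ * d0 - (1 / 2) * (D.κ₁ - 1) * D.toC.vol k y a b) *
            |g k - g' k| := by
  intro g hg g' hg' k y a ha b hb j x hx
  -- letters
  set X : C.Dom := x.1 with hXdef
  set l := D.cubes k y a b with hl
  set R : ℝ := D.R X with hRdef
  set ϱ₁ : ℝ := 1 / (2 * (cdir * ℓ k j)) with hϱ₁def
  set M : ℝ := 2 * (Real.exp (-(κ * C.d X)) * N j) with hM
  set δ₀ : ℝ := clip * (R / 2) * |g k - g' k| with hδ₀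
  have hj : C.scale X = j := hD.srcScale k y a j x hx
  have hRpos : 0 < R := hD.R_pos X
  have hcl : 0 < cdir * ℓ k j := mul_pos hcdir (hℓ k j)
  have hϱ₁ : 1 < ϱ₁ := by
    rw [hϱ₁def, lt_div_iff₀ (by positivity), one_mul]
    have := hhalf k j
    linarith
  have hϱ₁inv : ϱ₁⁻¹ = 2 * (cdir * ℓ k j) := by rw [hϱ₁def, one_div, inv_inv]
  have hR'R : R / 2 < R := by linarith
  have hδ₀0 : 0 ≤ δ₀ := by rw [hδ₀]; exact mul_nonneg (mul_nonneg hclip (by positivity)) (abs_nonneg _)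
  -- the inner disc lies inside every slice disc (`ϱ_inv_le`)
  have hϱ₁le : ∀ s : ℕ → ℝ, ϱ₁ ≤ D.ϱ k s y a b x := by
    intro s
    have hϱs : 0 < D.ϱ k s y a b x := zero_lt_one.trans (hD.ϱ_gt k s y a b x)
    have hinv : (D.ϱ k s y a b x)⁻¹ ≤ cdir * ℓ k j := hD.ϱ_inv_le k s y a ha b hb j x hx
    have h1 : 1 ≤ D.ϱ k s y a b x * (cdir * ℓ k j) := by
      have := mul_le_mul_of_nonneg_left hinv hϱs.le
      rwa [mul_inv_cancel₀ hϱs.ne'] at this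
    rw [hϱ₁def, div_le_iff₀ (by positivity)]
    nlinarith
  -- the size of the complex old term on the ball, from (1.18) on both copies of X
  have hMbd : ∀ z ∈ ball (0 : E) R, ‖lift (Ef g) X z‖ ≤ M := by
    intro z _
    have h1 := hT g hg z (X, true)
    have h2 := hT g hg z (X, false)
    have hsc : (doubleCarriers C).scale (X, true) = j := hj
    have hsc' : (doubleCarriers C).scale (X, false) = j := hj
    rw [hsc] at h1; rw [hsc'] at h2
    exact norm_lift_le h1 h2
  -- the slice-curve families at the two histories on the inner disc: analytic, inside R/2, δ₀-close
  have hΓ : ∀ s ∈ W, ∀ t ∈ sphere (0:ℂ) (D.r k), ∀ s' σ',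
      (∀ i ∈ l, s' i ∈ Icc (0:ℝ) 1 ∧ σ' i ∈ sphere (0:ℂ) (Real.exp D.κ₁)) →
        DifferentiableOn ℂ (D.cur k s y a b x t s' σ') (ball 0 ϱ₁) ∧
          ∀ τ ∈ ball (0:ℂ) ϱ₁, ‖D.cur k s y a b x t s' σ' τ‖ ≤ R / 2 :=
    fun s hs t ht s' σ' hsσ =>
      ⟨(hD.cur_an k s y a b x t ht s' σ' hsσ).1.mono (ball_subset_ball (hϱ₁le s)),
        fun τ hτ => hroom s hs k y a ha b hb j x hx t ht s' σ' hsσ τ hτ⟩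
  have hΓΓ' : ∀ t ∈ sphere (0:ℂ) (D.r k), ∀ s' σ',
      (∀ i ∈ l, s' i ∈ Icc (0:ℝ) 1 ∧ σ' i ∈ sphere (0:ℂ) (Real.exp D.κ₁)) →
        ∀ τ ∈ ball (0:ℂ) ϱ₁, ‖D.cur k g y a b x t s' σ' τ - D.cur k g' y a b x t s' σ' τ‖ ≤ δ₀ :=
    fun t ht s' σ' hsσ τ hτ => hlip g hg g' hg' k y a ha b hb j x hx t ht s' σ' hsσ τ hτ
  -- the closed-form coupling response of the (1.23)-functional along curves (sibling `NE9CurveRemainderLinear`)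
  have hrem := norm_curPiece_sub_curPiece_le (n := 5) hD.κ₁_ge (hD.r_pos k) (hE g hg X) hMbd hR'R hϱ₁ hδ₀0 l
    (D.cur k g y a b x) (D.cur k g' y a b x) (hΓ g hg) (hΓ g' hg') (hcont k g y a b x) (hcont k g' y a b x) hΓΓ' _ _
    (onContour_base D.κ₁ l)
  -- (1.25)
  have h125 := B13Sect1Arith.bound_125 (N := (l.length : ℝ)) (dY := D.dY k y) hD.κ₁_ge hD.d0_nonneg
    (hD.G1 k y a ha b hb)
  have hM0 : 0 ≤ M := by rw [hM]; exact mul_nonneg zero_le_two (mul_nonneg (Real.exp_pos _).le (hN0 j))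
  have hr0 : 0 < D.r k := hD.r_pos k
  -- assemble
  show |reIm x.2 (curPiece (Real.exp D.κ₁) (D.r k) (D.cubes k y a b) (lift (Ef g) x.1) 5 (D.cur k g y a b x)
      (fun _ => (0:ℝ)) (fun _ => ((Real.exp D.κ₁ : ℝ) : ℂ))) -
      reIm x.2 (curPiece (Real.exp D.κ₁) (D.r k) (D.cubes k y a b) (lift (Ef g) x.1) 5 (D.cur k g' y a b x)
      (fun _ => (0:ℝ)) (fun _ => ((Real.exp D.κ₁ : ℝ) : ℂ)))| ≤ D.Kp cdir k y * (64 * clip * Nbar) * ℓ k j ^ 5 *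
        Real.exp (-(κ * (doubleCarriers C).d x)) *
          Real.exp (-(1 / 8) * (D.κ₁ - 1) * D.toC.dY k y + (1 / 8) * D.κ₁ * d0 -
            (1 / 2) * (D.κ₁ - 1) * D.toC.vol k y a b) * |g k - g' k|
  have hdx : (doubleCarriers C).d x = C.d X := rfl
  have hdY : D.toC.dY k y = D.dY k y := rfl
  have hvol : D.toC.vol k y a b = (l.length : ℝ) := rfl
  rw [hdx, hdY, hvol, ← hXdef, ← hl, ← reIm_sub]
  -- the constant of `hrem`, simplified: (1/r)·(2⁵·(2M/(R − R/2)·δ₀)·ϱ₁⁻¹⁵) = (1/r)·2048·M·clip·(cdir ℓ)⁵·|Δg|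
  have hconst : 1 / D.r k * (2 ^ 5 * (2 * M / (R - R / 2) * δ₀) * ϱ₁⁻¹ ^ 5) =
      1 / D.r k * (2048 * M * clip * (cdir * ℓ k j) ^ 5) * |g k - g' k| := by
    rw [hϱ₁inv, hδ₀]
    field_simp
    ring
  have hNj : M ≤ 2 * (Real.exp (-(κ * C.d X)) * Nbar) := by
    rw [hM]; exact mul_le_mul_of_nonneg_left (mul_le_mul_of_nonneg_left (hNb j) (Real.exp_pos _).le) zero_le_two
  have hcl5 : 0 ≤ (cdir * ℓ k j) ^ 5 := pow_nonneg hcl.le 5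
  calc |reIm x.2 (curPiece (Real.exp D.κ₁) (D.r k) l (lift (Ef g) X) 5 (D.cur k g y a b x) (fun _ => (0:ℝ))
            (fun _ => ((Real.exp D.κ₁ : ℝ) : ℂ)) -
          curPiece (Real.exp D.κ₁) (D.r k) l (lift (Ef g) X) 5 (D.cur k g' y a b x) (fun _ => (0:ℝ))
            (fun _ => ((Real.exp D.κ₁ : ℝ) : ℂ)))|
        ≤ ‖curPiece (Real.exp D.κ₁) (D.r k) l (lift (Ef g) X) 5 (D.cur k g y a b x) (fun _ => (0:ℝ))
            (fun _ => ((Real.exp D.κ₁ : ℝ) : ℂ)) -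
          curPiece (Real.exp D.κ₁) (D.r k) l (lift (Ef g) X) 5 (D.cur k g' y a b x) (fun _ => (0:ℝ))
            (fun _ => ((Real.exp D.κ₁ : ℝ) : ℂ))‖ := abs_reIm_le _ _
    _ ≤ 1 / D.r k * (2 ^ 5 * (2 * M / (R - R / 2) * δ₀) * ϱ₁⁻¹ ^ 5) * Real.exp (-(D.κ₁ - 1) * l.length) := hrem
    _ = 1 / D.r k * (2048 * M * clip * (cdir * ℓ k j) ^ 5) * |g k - g' k| * Real.exp (-(D.κ₁ - 1) * l.length) := by
        rw [hconst]
    _ ≤ 1 / D.r k * (2048 * (2 * (Real.exp (-(κ * C.d X)) * Nbar)) * clip * (cdir * ℓ k j) ^ 5) * |g k - g' k| *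
          Real.exp (-(1 / 8) * (D.κ₁ - 1) * D.dY k y + (1 / 8) * D.κ₁ * d0 - (1 / 2) * (D.κ₁ - 1) * l.length) := by
        refine mul_le_mul ?_ h125 (Real.exp_pos _).le ?_
        · refine mul_le_mul_of_nonneg_right (mul_le_mul_of_nonneg_left ?_ (div_pos one_pos hr0).le) (abs_nonneg _)
          exact mul_le_mul_of_nonneg_right (mul_le_mul_of_nonneg_right
            (mul_le_mul_of_nonneg_left hNj (by norm_num)) hclip) hcl5
        · have : 0 ≤ Real.exp (-(κ * C.d X)) * Nbar := mul_nonneg (Real.exp_pos _).le ((hN0 j).trans (hNb j))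
          exact mul_nonneg (mul_nonneg (div_pos one_pos hr0).le (by positivity)) (abs_nonneg _)
    _ = D.Kp cdir k y * (64 * clip * Nbar) * ℓ k j ^ 5 * Real.exp (-(κ * C.d X)) *
          Real.exp (-(1 / 8) * (D.κ₁ - 1) * D.dY k y + (1 / 8) * D.κ₁ * d0 - (1 / 2) * (D.κ₁ - 1) * l.length) *
            |g k - g' k| := by
        simp only [CurData.Kp]; ring

/-! ## §2 Leaf A3 (`hTcup`) for the curve species' channel -/

/-- **LEAF A3 FOR THE CURVE SPECIES ON THE ANALYTIC CLASS (kernel).**  The END's channel-coupling-modulus clause `hTcup` for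
`T := cpieceChannel D.toC` read at the window family `E`: `|T k g (E g) y − T k g′ (E g) y| ≤ wt k y·(qT·|g k − g′ k|)` with the
S5 weight `wt := weightOf D.toC.frame κ₁ d₀ O1 (D.Kp c_dir)` (the SAME weight as the owner's `channelSizeAtStepNN_cur`) and the
k-UNIFORM constant **`qT := 64·clip·Nbar·c_Q·(1 − ω)⁻¹`** — leaf-09-g4's `channelCouplingModulus_cpiece` BY NAME fed with §1 and
the level counts `LevelCountsG D.toC.frame κ κ₁ O1 c_Q (ℓ⁵) (agePow ω)` ([II] p. 8, the (0.30) profile).  Displayed after this: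
`D.Admissible`, analyticity + (1.18) of the family, (c1)–(c3), `hhalf`, the counts, scalars.  NOT PRINTED, not claimed: that
Bałaban's (1.23) pieces, 𝐇_k and Lemma 4's curves meet these binders (O-NE9-1 ∕ O-NE9-5). [cite: Balaban1988RG2Cluster,
(1.21)-(1.29) pp.7-8, (1.33)-(1.36) p.9; Balaban1987RG1, (0.30) p.258, (3.53) p.280] -/
theorem channelCouplingModulus_cur {D : CurData C E ι α β γ δ} {ℓ : ℕ → ℕ → ℝ} {cdir d0 : ℝ} (hD : D.Admissible ℓ cdir d0)
    {Ef : Functional (doubleCarriers C) E} {W : Set (ℕ → ℝ)} {κ : ℝ} {N : ℕ → ℝ} {Nbar clip : ℝ}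
    (hE : ∀ g ∈ W, Ef g ∈ analyticClass D.R) (hT : TermSize Ef W κ N) (hN0 : ∀ j, 0 ≤ N j) (hNb : ∀ j, N j ≤ Nbar)
    (hclip : 0 ≤ clip) (hcdir : 0 < cdir) (hℓ : ∀ k j, 0 < ℓ k j) (hhalf : ∀ k j, cdir * ℓ k j < 1 / 2)
    (hcont : ∀ (k : ℕ) (s : ℕ → ℝ) (y : ι) (a : α) (b : β) (x : (doubleCarriers C).Dom),
      ContinuousOn (fun q : (ℂ × ((δ → ℝ) × (δ → ℂ))) × ℂ => D.cur k s y a b x q.1.1 q.1.2.1 q.1.2.2 q.2)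
        ((sphere (0:ℂ) (D.r k) ×ˢ {q | OnContour D.κ₁ (D.cubes k y a b) q.1 q.2}) ×ˢ sphere (0:ℂ) 1))
    (hlip : ∀ g ∈ W, ∀ g' ∈ W, ∀ (k : ℕ) (y : ι), ∀ a ∈ D.S0 k y, ∀ b ∈ D.SY k y a, ∀ (j : ℕ), ∀ x ∈ D.src k y a j,
      ∀ t ∈ sphere (0:ℂ) (D.r k), ∀ (s' : δ → ℝ) (σ' : δ → ℂ), OnContour D.κ₁ (D.cubes k y a b) s' σ' →
        ∀ τ ∈ ball (0:ℂ) (1 / (2 * (cdir * ℓ k j))),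
          ‖D.cur k g y a b x t s' σ' τ - D.cur k g' y a b x t s' σ' τ‖ ≤ clip * (D.R x.1 / 2) * |g k - g' k|)
    (hroom : ∀ g ∈ W, ∀ (k : ℕ) (y : ι), ∀ a ∈ D.S0 k y, ∀ b ∈ D.SY k y a, ∀ (j : ℕ), ∀ x ∈ D.src k y a j,
      ∀ t ∈ sphere (0:ℂ) (D.r k), ∀ (s' : δ → ℝ) (σ' : δ → ℂ), OnContour D.κ₁ (D.cubes k y a b) s' σ' →
        ∀ τ ∈ ball (0:ℂ) (1 / (2 * (cdir * ℓ k j))), ‖D.cur k g y a b x t s' σ' τ‖ ≤ D.R x.1 / 2)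
    {O1 cQ ω : ℝ} (hL : LevelCountsG D.toC.frame κ D.κ₁ O1 cQ (fun k j => ℓ k j ^ 5) (agePow ω)) (hO1 : 0 ≤ O1)
    (hcQ : 0 ≤ cQ) (hω0 : 0 ≤ ω) (hω1 : ω < 1) :
    ∀ g ∈ W, ∀ g' ∈ W, ∀ (k : ℕ) (y : ι),
      |cpieceChannel D.toC k g (Ef g) y - cpieceChannel D.toC k g' (Ef g) y| ≤
        weightOf D.toC.frame D.κ₁ d0 O1 (D.Kp cdir) k y * (64 * clip * Nbar * cQ * (1 - ω)⁻¹ * |g k - g' k|) :=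
  channelCouplingModulus_cpiece D.toC (cpieceResponse_cur hD hE hT hN0 hNb hclip hcdir hℓ hhalf hcont hlip hroom) hL
    (kp_nonneg hD) (mul_nonneg (mul_nonneg (by norm_num) hclip) ((hN0 0).trans (hNb 0))) hO1
    (fun k j => pow_nonneg (hℓ k j).le 5) hcQ hω0 hω1

end Species

/-! ## §3 The ray species' A3 (A3-REM) IS the special case γ(τ) = τ•A of §1 -/

section Ray

variable {C : Carriers} {E : Type} [NormedAddCommGroup E] [NormedSpace ℂ E] {ι α β γ δ : Type} [DecidableEq δ]

/-- **CONSISTENCY WITH A3-REM (leaf-03-g4's `NE9RemainderSpeciesCoupling.cpieceResponse_rem`, p213083): the ray species' per-piece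
coupling response IS the special case of §1.**  From A3-REM's binders on a ray datum `Dd` — `Dd.Admissible`, (d1) `hcont`, (d2)
`hlip`, (d3) `hhalf` — and the owner's displayed `hpos : 0 < dirB` (`RemData.Admissible.toCur`), §1 at the curve reading
`Dd.toCur` yields A3-REM's conclusion verbatim (`RemData.toCur_toC` and `Dd.toCur.Kp = KpOf Dd` are definitional): nothing
landed about the ray sub-case is lost. [folklore] -/
example {Dd : RemData C E ι α β γ δ} {ℓ : ℕ → ℕ → ℝ} {cdir d0 : ℝ} (hD : Dd.Admissible ℓ cdir d0)
    (hpos : ∀ k s y a b x, 0 < Dd.dirB k s y a b x)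
    {Ef : Functional (doubleCarriers C) E} {W : Set (ℕ → ℝ)} {κ : ℝ} {N : ℕ → ℝ} {Nbar clip : ℝ}
    (hE : ∀ g ∈ W, Ef g ∈ analyticClass Dd.R) (hT : TermSize Ef W κ N) (hN0 : ∀ j, 0 ≤ N j) (hNb : ∀ j, N j ≤ Nbar)
    (hclip : 0 ≤ clip) (hcdir : 0 < cdir) (hℓ : ∀ k j, 0 < ℓ k j) (hhalf : ∀ k j, cdir * ℓ k j < 1 / 2)
    (hcont : ∀ (k : ℕ) (s : ℕ → ℝ) (y : ι) (a : α) (b : β) (x : (doubleCarriers C).Dom),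
      ContinuousOn (fun p : ℂ × ((δ → ℝ) × (δ → ℂ)) => Dd.dir k s y a b x p.1 p.2.1 p.2.2)
        (sphere (0:ℂ) (Dd.r k) ×ˢ {q | OnContour Dd.κ₁ (Dd.cubes k y a b) q.1 q.2}))
    (hlip : ∀ g ∈ W, ∀ g' ∈ W, ∀ (k : ℕ) (y : ι), ∀ a ∈ Dd.S0 k y, ∀ b ∈ Dd.SY k y a, ∀ (j : ℕ), ∀ x ∈ Dd.src k y a j,
      ∀ t ∈ sphere (0:ℂ) (Dd.r k), ∀ (s' : δ → ℝ) (σ' : δ → ℂ), OnContour Dd.κ₁ (Dd.cubes k y a b) s' σ' →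
        ‖Dd.dir k g y a b x t s' σ' - Dd.dir k g' y a b x t s' σ'‖ ≤ clip * (cdir * ℓ k j * Dd.R x.1) * |g k - g' k|) :
    ∀ g ∈ W, ∀ g' ∈ W, ∀ (k : ℕ) (y : ι), ∀ a ∈ Dd.toC.S0 k y, ∀ b ∈ Dd.toC.SY k y a, ∀ (j : ℕ), ∀ x ∈ Dd.toC.src k y a j,
      |Dd.toC.piece k g y a b x (Ef g) - Dd.toC.piece k g' y a b x (Ef g)| ≤
        KpOf Dd cdir k y * (64 * clip * Nbar) * ℓ k j ^ 5 * Real.exp (-(κ * (doubleCarriers C).d x)) *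
          Real.exp (-(1 / 8) * (Dd.κ₁ - 1) * Dd.toC.dY k y + (1 / 8) * Dd.κ₁ * d0 - (1 / 2) * (Dd.κ₁ - 1) * Dd.toC.vol k y a b) *
            |g k - g' k| := by
  -- (c1): a ray is jointly continuous in (direction, τ)
  have hcont' : ∀ (k : ℕ) (s : ℕ → ℝ) (y : ι) (a : α) (b : β) (x : (doubleCarriers C).Dom),
      ContinuousOn (fun q : (ℂ × ((δ → ℝ) × (δ → ℂ))) × ℂ => Dd.toCur.cur k s y a b x q.1.1 q.1.2.1 q.1.2.2 q.2)
        ((sphere (0:ℂ) (Dd.toCur.r k) ×ˢ {q | OnContour Dd.toCur.κ₁ (Dd.toCur.cubes k y a b) q.1 q.2}) ×ˢ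
          sphere (0:ℂ) 1) := by
    intro k s y a b x
    show ContinuousOn (fun q : (ℂ × ((δ → ℝ) × (δ → ℂ))) × ℂ => q.2 • Dd.dir k s y a b x q.1.1 q.1.2.1 q.1.2.2)
      ((sphere (0:ℂ) (Dd.r k) ×ˢ {q | OnContour Dd.κ₁ (Dd.cubes k y a b) q.1 q.2}) ×ˢ sphere (0:ℂ) 1)
    exact continuousOn_snd.smul ((hcont k s y a b x).comp continuousOn_fst fun q hq => hq.1)
  -- (c2)/(c3) on the inner disc, from (d2) and `dirB_le` (previous `example`, re-derived inline)
  have hτ : ∀ (k j : ℕ), ∀ τ ∈ ball (0:ℂ) (1 / (2 * (cdir * ℓ k j))), ∀ R : ℝ, 0 ≤ R →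
      ‖τ‖ * (cdir * ℓ k j * R) ≤ R / 2 := by
    intro k j τ hτ R hR
    have hcl : 0 < cdir * ℓ k j := mul_pos hcdir (hℓ k j)
    have hc0 : cdir ≠ 0 := hcdir.ne'
    have hℓ0 : ℓ k j ≠ 0 := (hℓ k j).ne'
    rw [mem_ball_zero_iff] at hτ
    calc ‖τ‖ * (cdir * ℓ k j * R) ≤ 1 / (2 * (cdir * ℓ k j)) * (cdir * ℓ k j * R) :=
          mul_le_mul_of_nonneg_right hτ.le (mul_nonneg hcl.le hR)
      _ = R / 2 := by field_simp
  have hlip' : ∀ g ∈ W, ∀ g' ∈ W, ∀ (k : ℕ) (y : ι), ∀ a ∈ Dd.toCur.S0 k y, ∀ b ∈ Dd.toCur.SY k y a, ∀ (j : ℕ),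
      ∀ x ∈ Dd.toCur.src k y a j, ∀ t ∈ sphere (0:ℂ) (Dd.toCur.r k), ∀ (s' : δ → ℝ) (σ' : δ → ℂ),
        OnContour Dd.toCur.κ₁ (Dd.toCur.cubes k y a b) s' σ' → ∀ τ ∈ ball (0:ℂ) (1 / (2 * (cdir * ℓ k j))),
          ‖Dd.toCur.cur k g y a b x t s' σ' τ - Dd.toCur.cur k g' y a b x t s' σ' τ‖ ≤
            clip * (Dd.toCur.R x.1 / 2) * |g k - g' k| := by
    intro g hg g' hg' k y a ha b hb j x hx t ht s' σ' hsσ τ hτ'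
    show ‖τ • Dd.dir k g y a b x t s' σ' - τ • Dd.dir k g' y a b x t s' σ'‖ ≤ clip * (Dd.R x.1 / 2) * |g k - g' k|
    rw [← smul_sub, norm_smul]
    have h := hlip g hg g' hg' k y a ha b hb j x hx t ht s' σ' hsσ
    calc ‖τ‖ * ‖Dd.dir k g y a b x t s' σ' - Dd.dir k g' y a b x t s' σ'‖
          ≤ ‖τ‖ * (clip * (cdir * ℓ k j * Dd.R x.1) * |g k - g' k|) := mul_le_mul_of_nonneg_left h (norm_nonneg _)
      _ = clip * (‖τ‖ * (cdir * ℓ k j * Dd.R x.1)) * |g k - g' k| := by ring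
      _ ≤ clip * (Dd.R x.1 / 2) * |g k - g' k| :=
          mul_le_mul_of_nonneg_right (mul_le_mul_of_nonneg_left (hτ k j τ hτ' _ (hD.R_pos x.1).le) hclip)
            (abs_nonneg _)
  have hroom' : ∀ g ∈ W, ∀ (k : ℕ) (y : ι), ∀ a ∈ Dd.toCur.S0 k y, ∀ b ∈ Dd.toCur.SY k y a, ∀ (j : ℕ),
      ∀ x ∈ Dd.toCur.src k y a j, ∀ t ∈ sphere (0:ℂ) (Dd.toCur.r k), ∀ (s' : δ → ℝ) (σ' : δ → ℂ),
        OnContour Dd.toCur.κ₁ (Dd.toCur.cubes k y a b) s' σ' →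
          ∀ τ ∈ ball (0:ℂ) (1 / (2 * (cdir * ℓ k j))), ‖Dd.toCur.cur k g y a b x t s' σ' τ‖ ≤ Dd.toCur.R x.1 / 2 := by
    intro g _ k y a ha b hb j x hx t ht s' σ' hsσ τ hτ'
    show ‖τ • Dd.dir k g y a b x t s' σ'‖ ≤ Dd.R x.1 / 2
    rw [norm_smul]
    calc ‖τ‖ * ‖Dd.dir k g y a b x t s' σ'‖ ≤ ‖τ‖ * (cdir * ℓ k j * Dd.R x.1) :=
          mul_le_mul_of_nonneg_left ((hD.dir_le k g y a b x t ht s' σ' hsσ).trans (hD.dirB_le k g y a ha b hb j x hx))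
            (norm_nonneg _)
      _ ≤ Dd.R x.1 / 2 := hτ k j τ hτ' _ (hD.R_pos x.1).le
  rw [← Dd.toCur_toC]
  exact cpieceResponse_cur (hD.toCur hpos) hE hT hN0 hNb hclip hcdir hℓ hhalf hcont' hlip' hroom'

end Ray

end Summit.QuantumFields.BalabanUV.T4Continuum.NE9CurveSpeciesCoupling

end
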